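import Summits.NavierStokesRegularity.NavierStokesRegularity.Theorems.StrainClockLocalDefs
import HarnessLib

/-!
# StrainClockLocalCompositions — S39 compositions I (§4 up to `forwardStrainSmoothing_of`)

P0-39 part 2 of 4: §4 first half (`const_of_strainQuad_nonpos`, `weightedSlab_bound`, `localStrainTameness_of`, `strainQuad_le_of_localStrainTameness`, `penalisedClockLiouville_of`, `forwardStrainSmoothing_of`) of nsreg-p1 g32's `r37/Sketch39.v2.lean` sha16 8afe3b1c706e6582 (ROUND-37 S39 «LocalStrainClock»
65850a92b7bcd814), every declaration byte-identical, order preserved; cut prepared by ns-s29-p2 g4 (planner's suggested split,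
compositions halved for the 400-line cap), `--supports stmt-NavierStokesRegularity-0056 --as helper`.

HONEST FRAME: door family S39 «LocalStrainClock» = local / penalised / integrated strain-clock CRITERIA about HYPOTHETICAL blow-up
profiles; items 0056 `NoTypeII`, 10661 and NS regularity are NOT proved; nothing here is a route or a summit statement.
-/

noncomputable section

open MeasureTheory Set Function Filter Metric Real InnerProductSpace
open _root_.Topology
open scoped ENNReal NNReal RealInnerProductSpace ContDiff Laplacian Interval
open Literature.Analysis Literature.Analysis.FluidPDE
open Literature.Analysis.FluidPDE.VorticityDirectionDynamics

set_option linter.dupNamespace false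

namespace Summit.NavierStokesRegularity.NavierStokesRegularity.Theorems.StrainDoors

open Summit.NavierStokesRegularity.NavierStokesRegularity.Theorems.ArgmaxDoors

-- nested operator types (second derivatives)
set_option maxSynthPendingDepth 3
/-! ## §4 Compositions -/

/-- From `S ≤ 0` (as a form, all times `s < 0`) to `u(s,·)` constant, in the ancient frame: trace step + «RigidMotion».
[folklore] -/
theorem const_of_strainQuad_nonpos (hR : RigidMotion) {ν U : ℝ}
    {u : ℝ → (EuclideanSpace ℝ (Fin 3)) → (EuclideanSpace ℝ (Fin 3))} {p : ℝ → (EuclideanSpace ℝ (Fin 3)) → ℝ}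
    (hS : ∀ s₁ s₂ : ℝ, s₁ < s₂ → s₂ < 0 → IsClassicalNSSolutionOn (Icc s₁ s₂) ν 0 u p)
    (hU : ∀ s : ℝ, s < 0 → ∀ x : EuclideanSpace ℝ (Fin 3), ‖u s x‖ ≤ U) {s : ℝ} (hs : s < 0)
    (hq : ∀ (x e : EuclideanSpace ℝ (Fin 3)), ‖e‖ = 1 → strainQuad u s x e ≤ 0) :
    ∀ x y : EuclideanSpace ℝ (Fin 3), u s x = u s y := by
  intro x y
  have hsol := hS (s - 1) s (by linarith) hs
  have hmem : s ∈ Icc (s - 1) s := ⟨by linarith, le_rfl⟩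
  have hv : ContDiff ℝ 2 (u s) := (hsol.contDiff_velocity hmem).of_le (by norm_cast)
  exact hR (u s) hv
    (inner_fderiv_apply_self_eq_zero_of_nonpos_of_isDivFree (u s) (hsol.divFree s hmem) fun x e he => hq x e he)
    ⟨U, hU s hs⟩ x y

/-- **THE WEIGHTED ONE-SLAB BOUND** (engine of C1 and C3). On a closed slab `[s₁,s₂]`: classical solution with
`|u| ≤ U` (`U ≥ 0`) and `‖∇u‖ ≤ K`; feed sub-parity `H ≤ c q²` at the charged exact `ε`-penalised maximisers at times
`s ∈ (s₁,s₂]`. THEN `(1+ε|x|²)⁻¹⟪∇u(s₂,x)e,e⟫ ≤ η/κ + (L'⁻¹ + κ(s₂ − s₁))⁻¹`, `η = 6νε + √εU`, `κ = 1 − c`,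
`L' = max K 1`. Barrier `B = η/κ + D⁻¹`, `D = L'⁻¹ + κ(s − s₁)`, `B' = −κD⁻²`, `φ = −κB + η`:
`φB = −κ(η/κ)D⁻¹ − κD⁻² ≤ B'`; growth at a charged point `Q = wq > B`: E1_S♭ (same `ε`) + F_S∘ + sub-parity +
`|u| ≤ U` give `∂ₛq ≤ −κq² + ηq`, and `w ≤ 1` gives `w∂ₛq ≤ −κQq + ηQ ≤ (−κB + η)Q`; start `wq(s₁) ≤ L' ≤ B(s₁)`.
[folklore] -/
theorem weightedSlab_bound (hFr : StrainFrameOn) (hW : StrainThresholdWeightedOn)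
    {ν U K ε c s₁ s₂ : ℝ} (hν : 0 < ν) (hε : 0 < ε) (hc : c < 1) (h12 : s₁ < s₂) (hU0 : 0 ≤ U)
    {u : ℝ → (EuclideanSpace ℝ (Fin 3)) → (EuclideanSpace ℝ (Fin 3))} {p : ℝ → (EuclideanSpace ℝ (Fin 3)) → ℝ}
    (hsol : IsClassicalNSSolutionOn (Icc s₁ s₂) ν 0 u p)
    (hU : ∀ s ∈ Icc s₁ s₂, ∀ x : EuclideanSpace ℝ (Fin 3), ‖u s x‖ ≤ U)
    (hK : ∀ s ∈ Icc s₁ s₂, ∀ x : EuclideanSpace ℝ (Fin 3), ‖fderiv ℝ (u s) x‖ ≤ K)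
    (hhyp : ∀ s ∈ Ioc s₁ s₂, ∀ (x e : EuclideanSpace ℝ (Fin 3)), IsStrainPenalisedArgmax ε u s x e →
      0 < strainQuad u s x e → strainFeed u p s x e ≤ c * strainQuad u s x e ^ 2) :
    ∀ (x e : EuclideanSpace ℝ (Fin 3)), ‖e‖ = 1 →
      (1 + ε * ‖x‖ ^ 2)⁻¹ * strainQuad u s₂ x e ≤
        (6 * ν * ε + Real.sqrt ε * U) / (1 - c) + ((max K 1)⁻¹ + (1 - c) * (s₂ - s₁))⁻¹ := by
  intro x e he
  set κ : ℝ := 1 - c with hκ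
  have hκ0 : 0 < κ := by rw [hκ]; linarith
  set η : ℝ := 6 * ν * ε + Real.sqrt ε * U with hη
  have hη0 : 0 ≤ η := by
    have h1 : 0 ≤ 6 * ν * ε := by positivity
    have h2 : 0 ≤ Real.sqrt ε * U := mul_nonneg (Real.sqrt_nonneg ε) hU0
    rw [hη]; linarith
  set a : ℝ := η / κ with ha
  have ha0 : 0 ≤ a := div_nonneg hη0 hκ0.le
  have hκa : κ * a = η := by rw [ha]; field_simp
  set L' : ℝ := max K 1 with hL'
  have hL'0 : 0 < L' := lt_of_lt_of_le one_pos (le_max_right _ _)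
  have hKb : ∀ s ∈ Icc s₁ s₂, ∀ y : EuclideanSpace ℝ (Fin 3), ‖fderiv ℝ (u s) y‖ ≤ L' :=
    fun s hs y => (hK s hs y).trans (le_max_left _ _)
  -- the weight
  have hwpos : ∀ y : EuclideanSpace ℝ (Fin 3), 0 < (1 + ε * ‖y‖ ^ 2)⁻¹ := fun y => by positivity
  have hw1 : ∀ y : EuclideanSpace ℝ (Fin 3), (1 + ε * ‖y‖ ^ 2)⁻¹ ≤ 1 := fun y =>
    inv_le_one_of_one_le₀ (by nlinarith [sq_nonneg ‖y‖, hε.le])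
  -- the barrier
  set D : ℝ → ℝ := fun s => L'⁻¹ + κ * (s - s₁) with hD
  have hDpos : ∀ s ∈ Icc s₁ s₂, 0 < D s := fun s hs => by
    have h1 : 0 ≤ κ * (s - s₁) := mul_nonneg hκ0.le (sub_nonneg.2 hs.1)
    have h2 : 0 < L'⁻¹ := inv_pos.2 hL'0
    simp only [hD]
    linarith
  set B : ℝ → ℝ := fun s => a + (D s)⁻¹ with hB
  set B' : ℝ → ℝ := fun s => -κ / (D s) ^ 2 with hB'
  set φ : ℝ → ℝ := fun s => -κ * B s + η with hφ
  have hBc : ContinuousOn B (Icc s₁ s₂) := by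
    have hDc : Continuous D :=
      continuous_const.add (continuous_const.mul (continuous_id.sub continuous_const))
    exact continuousOn_const.add (hDc.continuousOn.inv₀ fun s hs => (hDpos s hs).ne')
  have hBpos : ∀ s ∈ Icc s₁ s₂, 0 < B s := fun s hs => by
    simp only [hB]
    exact add_pos_of_nonneg_of_pos ha0 (inv_pos.2 (hDpos s hs))
  have hBd : ∀ s ∈ Icc s₁ s₂, HasDerivWithinAt B (B' s) (Icc s₁ s₂) s := by
    intro s hs
    have hDd : HasDerivAt D κ s := by
      have h1 : HasDerivAt (fun r : ℝ => L'⁻¹ + κ * (r - s₁)) (0 + κ * 1) s :=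
        (hasDerivAt_const s L'⁻¹).add (((hasDerivAt_id s).sub_const s₁).const_mul κ)
      rw [zero_add, mul_one] at h1
      exact h1
    have h := (hDd.inv (hDpos s hs).ne').const_add a
    exact h.hasDerivWithinAt
  have hsuper : ∀ s ∈ Icc s₁ s₂, φ s * B s ≤ B' s := by
    intro s hs
    have hD0 : D s ≠ 0 := (hDpos s hs).ne'
    have hd : 0 < (D s)⁻¹ := inv_pos.2 (hDpos s hs)
    have h1 : φ s * B s = -(κ * a) * (D s)⁻¹ - κ * (D s)⁻¹ ^ 2 := by
      simp only [hφ, hB]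
      linear_combination (-(D s)⁻¹ - a) * hκa
    have h2 : B' s = -κ * (D s)⁻¹ ^ 2 := by
      simp only [hB']
      rw [div_eq_mul_inv, ← inv_pow]
    rw [h1, h2, hκa]
    nlinarith [mul_nonneg hη0 hd.le]
  -- growth at the charged exact penalised maximisers
  have hrate : ∀ s ∈ Ioc s₁ s₂, ∀ (x e : EuclideanSpace ℝ (Fin 3)), ‖e‖ = 1 →
      (∀ (y e' : EuclideanSpace ℝ (Fin 3)), ‖e'‖ = 1 →
        (1 + ε * ‖y‖ ^ 2)⁻¹ * strainQuad u s y e' ≤ (1 + ε * ‖x‖ ^ 2)⁻¹ * strainQuad u s x e) →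
      B s < (1 + ε * ‖x‖ ^ 2)⁻¹ * strainQuad u s x e →
      (1 + ε * ‖x‖ ^ 2)⁻¹ * strainRateOn (Icc s₁ s₂) u s x e ≤
        φ s * ((1 + ε * ‖x‖ ^ 2)⁻¹ * strainQuad u s x e) := by
    intro s hs x e he hpen hbig
    have hsI : s ∈ Icc s₁ s₂ := ⟨hs.1.le, hs.2⟩
    have hBs := hBpos s hsI
    have hwx := hwpos x
    have hw1x := hw1 x
    have hQ0 : 0 < (1 + ε * ‖x‖ ^ 2)⁻¹ * strainQuad u s x e := hBs.trans hbig
    have hq0 : 0 < strainQuad u s x e := by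
      by_contra hle
      push Not at hle
      have : (1 + ε * ‖x‖ ^ 2)⁻¹ * strainQuad u s x e ≤ 0 := mul_nonpos_of_nonneg_of_nonpos hwx.le hle
      linarith
    have hsm : ContDiff ℝ ∞ (u s) := hsol.smooth_velocity.contDiff_slice hsI
    have heq := hFr ν s₁ s₂ h12 u p hsol s hsI x e
    have hE := strainGrowthWeighted ν ε hν.le hε (u s) (p s) hsm x e he (fun y => hpen y e he) hq0.le _ heq
    have hfeed := hhyp s hs x e ⟨he, hpen⟩ hq0
    have hux : ‖u s x‖ ≤ U := hU s hsI x
    have h1 : strainRateOn (Icc s₁ s₂) u s x e ≤ -(strainQuad u s x e) ^ 2 + strainFeed u p s x e +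
        (6 * ν * ε + Real.sqrt ε * ‖u s x‖) * strainQuad u s x e := by
      unfold strainRateOn strainQuad strainFeed pressureHess
      linarith [hE]
    have hallow : (6 * ν * ε + Real.sqrt ε * ‖u s x‖) * strainQuad u s x e ≤ η * strainQuad u s x e := by
      apply mul_le_mul_of_nonneg_right _ hq0.le
      have := mul_le_mul_of_nonneg_left hux (Real.sqrt_nonneg ε)
      rw [hη]; linarith
    have h2 : strainRateOn (Icc s₁ s₂) u s x e ≤ -κ * strainQuad u s x e ^ 2 + η * strainQuad u s x e := by
      have h3 : -(strainQuad u s x e) ^ 2 + c * strainQuad u s x e ^ 2 = -κ * strainQuad u s x e ^ 2 := by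
        rw [hκ]; ring
      linarith [h1, hallow, hfeed, h3]
    have h4 : (1 + ε * ‖x‖ ^ 2)⁻¹ * strainRateOn (Icc s₁ s₂) u s x e ≤
        (1 + ε * ‖x‖ ^ 2)⁻¹ * (-κ * strainQuad u s x e ^ 2 + η * strainQuad u s x e) :=
      mul_le_mul_of_nonneg_left h2 hwx.le
    have hwq : (1 + ε * ‖x‖ ^ 2)⁻¹ * strainQuad u s x e ≤ strainQuad u s x e :=
      mul_le_of_le_one_left hq0.le hw1x
    have hBq : B s ≤ strainQuad u s x e := hbig.le.trans hwq
    have h5 : κ * ((1 + ε * ‖x‖ ^ 2)⁻¹ * strainQuad u s x e) * B s ≤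
        κ * ((1 + ε * ‖x‖ ^ 2)⁻¹ * strainQuad u s x e) * strainQuad u s x e :=
      mul_le_mul_of_nonneg_left hBq (mul_nonneg hκ0.le hQ0.le)
    have h6 : (1 + ε * ‖x‖ ^ 2)⁻¹ * (-κ * strainQuad u s x e ^ 2 + η * strainQuad u s x e) =
        -(κ * ((1 + ε * ‖x‖ ^ 2)⁻¹ * strainQuad u s x e) * strainQuad u s x e) +
          η * ((1 + ε * ‖x‖ ^ 2)⁻¹ * strainQuad u s x e) := by ring
    have h7 : φ s * ((1 + ε * ‖x‖ ^ 2)⁻¹ * strainQuad u s x e) =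
        -(κ * ((1 + ε * ‖x‖ ^ 2)⁻¹ * strainQuad u s x e) * B s) +
          η * ((1 + ε * ‖x‖ ^ 2)⁻¹ * strainQuad u s x e) := by
      simp only [hφ]; ring
    rw [h7]
    rw [h6] at h4
    linarith [h4, h5]
  have hinit : ∀ (y e' : EuclideanSpace ℝ (Fin 3)), ‖e'‖ = 1 →
      (1 + ε * ‖y‖ ^ 2)⁻¹ * strainQuad u s₁ y e' ≤ B s₁ := by
    intro y e' he'
    have h1 : B s₁ = a + L' := by simp only [hB, hD, sub_self, mul_zero, add_zero, inv_inv]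
    rw [h1]
    have hs₁ : s₁ ∈ Icc s₁ s₂ := ⟨le_rfl, h12.le⟩
    by_cases hq : 0 ≤ strainQuad u s₁ y e'
    · calc (1 + ε * ‖y‖ ^ 2)⁻¹ * strainQuad u s₁ y e' ≤ strainQuad u s₁ y e' :=
            mul_le_of_le_one_left hq (hw1 y)
        _ ≤ L' := (strainQuad_le_opNorm u s₁ y he').trans (hKb s₁ hs₁ y)
        _ ≤ a + L' := by linarith
    · push Not at hq
      have : (1 + ε * ‖y‖ ^ 2)⁻¹ * strainQuad u s₁ y e' ≤ 0 :=
        mul_nonpos_of_nonneg_of_nonpos (hwpos y).le hq.le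
      linarith
  have hmain := hW ν s₁ s₂ ε hν h12 hε u p hsol ⟨L', hKb⟩ B B' φ hBc hBpos hBd hsuper hrate hinit s₂
    ⟨h12.le, le_rfl⟩ x e he
  simpa only [hB, hD, ha, hη, hκ] using hmain

/-- **Door C1 «LocalStrainTameness» from the plates**: the weighted one-slab bound on `[s₁,s₂]` for every `s₁ < s₂`,
then `s₁ → −∞`: if `Q = wq(s₂) > η/κ`, the slab with `κ(s₂ − s₁) = 2/(Q − η/κ)` gives `Q ≤ η/κ + (Q − η/κ)/2`.
[folklore] -/
theorem localStrainTameness_of (hFr : StrainFrameOn) (hW : StrainThresholdWeightedOn) : LocalStrainTameness := by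
  intro ν U L ε c hν hε hc u p hS hU hL hhyp s₂ hs₂ x e he
  set κ : ℝ := 1 - c with hκ
  have hκ0 : 0 < κ := by rw [hκ]; linarith
  have hU0 : 0 ≤ U := (norm_nonneg _).trans (hU s₂ hs₂ x)
  set a : ℝ := (6 * ν * ε + Real.sqrt ε * U) / (1 - c) with ha
  set L' : ℝ := max L 1 with hL'
  have hL'0 : 0 < L' := lt_of_lt_of_le one_pos (le_max_right _ _)
  have hslab : ∀ s₁ : ℝ, s₁ < s₂ →
      (1 + ε * ‖x‖ ^ 2)⁻¹ * strainQuad u s₂ x e ≤ a + (L'⁻¹ + κ * (s₂ - s₁))⁻¹ := by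
    intro s₁ h12
    exact weightedSlab_bound hFr hW hν hε hc h12 hU0 (hS s₁ s₂ h12 hs₂)
      (fun s hs y => hU s (lt_of_le_of_lt hs.2 hs₂) y) (fun s hs y => hL s (lt_of_le_of_lt hs.2 hs₂) y)
      (fun s hs y e' hpen hq => hhyp s (lt_of_le_of_lt hs.2 hs₂) y e' hpen hq) x e he
  by_contra hbig
  push Not at hbig
  set Q : ℝ := (1 + ε * ‖x‖ ^ 2)⁻¹ * strainQuad u s₂ x e with hQ
  have hg : 0 < Q - a := by linarith
  have hκg : 0 < κ * (Q - a) := mul_pos hκ0 hg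
  have h := hslab (s₂ - 2 / (κ * (Q - a))) (by have := div_pos two_pos hκg; linarith)
  have h3 : L'⁻¹ + κ * (s₂ - (s₂ - 2 / (κ * (Q - a)))) = L'⁻¹ + 2 / (Q - a) := by
    field_simp
    ring
  rw [h3] at h
  have h5 : 0 < 2 / (Q - a) := div_pos two_pos hg
  have h4 : 2 / (Q - a) < L'⁻¹ + 2 / (Q - a) := by
    have := inv_pos.2 hL'0
    linarith
  have h6 : (L'⁻¹ + 2 / (Q - a))⁻¹ < (2 / (Q - a))⁻¹ := (inv_lt_inv₀ (h5.trans h4) h5).2 h4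
  rw [inv_div] at h6
  have h7 : a + (Q - a) / 2 < Q := by linarith
  linarith

/-- pointwise form of C1: `⟪∇u(s,x)e,e⟫ ≤ (1+ε|x|²)·(6νε + √εU)/(1−c)`. [folklore] -/
theorem strainQuad_le_of_localStrainTameness (h1 : LocalStrainTameness) :
    ∀ (ν U L ε c : ℝ), 0 < ν → 0 < ε → c < 1 →
    ∀ (u : ℝ → (EuclideanSpace ℝ (Fin 3)) → (EuclideanSpace ℝ (Fin 3)))
      (p : ℝ → (EuclideanSpace ℝ (Fin 3)) → ℝ),
      (∀ s₁ s₂ : ℝ, s₁ < s₂ → s₂ < 0 → IsClassicalNSSolutionOn (Icc s₁ s₂) ν 0 u p) →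
      (∀ s : ℝ, s < 0 → ∀ x : EuclideanSpace ℝ (Fin 3), ‖u s x‖ ≤ U) →
      (∀ s : ℝ, s < 0 → ∀ x : EuclideanSpace ℝ (Fin 3), ‖fderiv ℝ (u s) x‖ ≤ L) →
      (∀ s : ℝ, s < 0 → ∀ (x e : EuclideanSpace ℝ (Fin 3)), IsStrainPenalisedArgmax ε u s x e →
        0 < strainQuad u s x e → strainFeed u p s x e ≤ c * strainQuad u s x e ^ 2) →
      ∀ s : ℝ, s < 0 → ∀ (x e : EuclideanSpace ℝ (Fin 3)), ‖e‖ = 1 →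
        strainQuad u s x e ≤ (1 + ε * ‖x‖ ^ 2) * ((6 * ν * ε + Real.sqrt ε * U) / (1 - c)) := by
  intro ν U L ε c hν hε hc u p hS hU hL hhyp s hs x e he
  have h := h1 ν U L ε c hν hε hc u p hS hU hL hhyp s hs x e he
  have hw : 0 < 1 + ε * ‖x‖ ^ 2 := by positivity
  calc strainQuad u s x e = (1 + ε * ‖x‖ ^ 2) * ((1 + ε * ‖x‖ ^ 2)⁻¹ * strainQuad u s x e) := by
        field_simp
    _ ≤ (1 + ε * ‖x‖ ^ 2) * ((6 * ν * ε + Real.sqrt ε * U) / (1 - c)) := mul_le_mul_of_nonneg_left h hw.le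

/-- **Door C2 «PenalisedClockLiouville» from C1 and «RigidMotion»**: for fixed `(s,x,e)` the pointwise bound
`(1+ε|x|²)(6νε + √εU)/(1−c) → 0` as `ε ↓ 0`, so `S ≤ 0`; trace step; Killing rigidity. [folklore] -/
theorem penalisedClockLiouville_of (h1 : LocalStrainTameness) (hR : RigidMotion) : PenalisedClockLiouville := by
  intro ν U L c hν hc u p hS hU hL hhyp s hs
  refine const_of_strainQuad_nonpos hR hS hU hs ?_
  intro z e he
  have hb : ∀ ε : ℝ, 0 < ε → ε ≤ 1 →
      strainQuad u s z e ≤ (1 + ε * ‖z‖ ^ 2) * ((6 * ν * ε + Real.sqrt ε * U) / (1 - c)) :=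
    fun ε hε hε1 => strainQuad_le_of_localStrainTameness h1 ν U L ε c hν hε hc u p hS hU hL (hhyp ε hε hε1)
      s hs z e he
  have hlim : Tendsto (fun ε : ℝ => (1 + ε * ‖z‖ ^ 2) * ((6 * ν * ε + Real.sqrt ε * U) / (1 - c)))
      (𝓝[>] 0) (𝓝 0) := by
    have hA : Tendsto (fun ε : ℝ => 1 + ε * ‖z‖ ^ 2) (𝓝[>] 0) (𝓝 1) := by
      have hc' : Continuous fun ε : ℝ => 1 + ε * ‖z‖ ^ 2 := by fun_prop
      have h := hc'.tendsto 0
      simp only [zero_mul, add_zero] at h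
      exact tendsto_nhdsWithin_of_tendsto_nhds h
    have hB : Tendsto (fun ε : ℝ => (6 * ν * ε + Real.sqrt ε * U) / (1 - c)) (𝓝[>] 0) (𝓝 0) := by
      simpa using (tendsto_allowance ν U).div_const (1 - c)
    simpa using hA.mul hB
  have hev : ∀ᶠ ε in 𝓝[>] (0 : ℝ),
      strainQuad u s z e ≤ (1 + ε * ‖z‖ ^ 2) * ((6 * ν * ε + Real.sqrt ε * U) / (1 - c)) := by
    filter_upwards [Ioc_mem_nhdsGT (zero_lt_one' ℝ)] with ε hε
    exact hb ε hε.1 hε.2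
  exact ge_of_tendsto hlim hev

/-- **Door C3 «ForwardStrainSmoothing» from the plates**: the weighted one-slab bound on `[t₀,t]` (a closed sub-slab
of `[0,T)`, `IsClassicalNSSolutionOn.mono`), and `(L'⁻¹ + κ(t − t₀))⁻¹ ≤ 1/(κ(t − t₀))`. [folklore] -/
theorem forwardStrainSmoothing_of (hFr : StrainFrameOn) (hW : StrainThresholdWeightedOn) :
    ForwardStrainSmoothing := by
  intro ν T t₀ U ε c hν ht₀ hT hε hc u p hsol hU hK hhyp t ht x e he
  have h0t : t₀ < t := ht.1
  have htT : t < T := ht.2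
  have hsub : Icc t₀ t ⊆ Ico 0 T := fun s hs => ⟨ht₀.trans hs.1, lt_of_le_of_lt hs.2 htT⟩
  have hsol' : IsClassicalNSSolutionOn (Icc t₀ t) ν 0 u p := hsol.mono hsub (uniqueDiffOn_Icc h0t)
  obtain ⟨K, hK'⟩ := hK t htT
  have hU0 : 0 ≤ U := (norm_nonneg _).trans (hU t₀ ⟨le_rfl, hT⟩ x)
  set κ : ℝ := 1 - c with hκ
  have hκ0 : 0 < κ := by rw [hκ]; linarith
  have h := weightedSlab_bound hFr hW hν hε hc h0t hU0 hsol'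
    (fun s hs y => hU s ⟨hs.1, lt_of_le_of_lt hs.2 htT⟩ y) hK'
    (fun s hs y e' hpen hq => hhyp s ⟨hs.1.le, lt_of_le_of_lt hs.2 htT⟩ y e' hpen hq) x e he
  have hL'0 : 0 < max K 1 := lt_of_lt_of_le one_pos (le_max_right _ _)
  have hpos : 0 < (1 - c) * (t - t₀) := mul_pos hκ0 (by linarith)
  have hle : ((max K 1)⁻¹ + (1 - c) * (t - t₀))⁻¹ ≤ 1 / ((1 - c) * (t - t₀)) := by
    rw [one_div]
    apply inv_anti₀ hpos
    have := inv_pos.2 hL'0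
    linarith
  linarith [h, hle]

end Summit.NavierStokesRegularity.NavierStokesRegularity.Theorems.StrainDoors

end
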